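import Summits.BirchSwinnertonDyer.BirchSwinnertonDyer.Theorems.GenusKolyvaginAtTwoShaCardDvdPowAtTwoRTPairCount
import Summits.BirchSwinnertonDyer.BirchSwinnertonDyer.Theorems.GenusKolyvaginAtTwoShaCardDvdPowAtTwoRTSandwich
import Summits.BirchSwinnertonDyer.BirchSwinnertonDyer.Theorems.GenusKolyvaginAtTwoShaCardDvdPowAtTwoRTRootNumberOfMinimalTwin
import Summits.BirchSwinnertonDyer.BirchSwinnertonDyer.Theorems.GenusKolyvaginAtTwoShaCardDvdPowAtTwoRTShaFiniteAtTwo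
import HarnessLib

/-!
# Route `GenusKolyvaginAtTwo`, crux U_T `ShaCardDvdPowAtTwoRT` (stmt-BirchSwinnertonDyer-23658), LINE 19 `rational_pair_descent` —
# U_T ON THE CUT R7-d WITHOUT THE SIGN BINDER: `#Ш(E/K)[2^∞] ∣ 2^(2M₀)` from a 2-Selmer-minimal globally minimal twin with `ord₂ c(Wd) ≤ 1`

Seat `bsd-line-gk2-p5` g30 (WIDTH-5 attach, cell `bsd-f1-sign2`), `--supports stmt-BirchSwinnertonDyer-23658` (helper; closes nothing).
THEOREMS ONLY (no definition, no named fact, no `sorry`).  BSD is NOT proved by any of this; U_T AS FILED is NOT proved (its declared residual off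
the cut remains); nothing is closed.

WHAT.  LINE 19's two live stubs are landed BY NAME — PAIRCOUNT `RationalPairDescent.stub_shaRatCardDvdOfMinimalTwin` (gk2-p4 g22, p749270)
and SANDWICH′ `RationalPairDescent.stub_sandwichOfMinimalTwin` (LEAD gk2-p1 g19, p750599) — both with the binder `W.rootNumber = 1`.  By (W1)
`PlusDescent.rootNumber_eq_one_of_natCard_selmerGroup_twin_eq_two_onHabitat` (this seat, p750865) that binder FOLLOWS from `#Sel₂(Wd) = 2` on U_T's
frame, so U_T's conclusion holds on the cut «∃ a globally minimal elliptic `ℚ`-model `Wd ≅ E^(d_K)` with `#Sel₂(Wd) = 2` and `ord₂ c(Wd) ≤ 1`» with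
NO `w(E) = 1` / `W.analyticRank = 0` hypothesis:

* `shaCardDvdPowAtTwoRT_onCut_of_selmerMinimalTwin` — U_T's rev-37 binders VERBATIM through `hndiv`, then the three cut binders, then U_T's
  conclusion (= the LEAD's proposed restatement U_T′ of `RESTATEMENT-UT-cut-g19.md` §2 with its `W.rootNumber = 1 →` DELETED);
* `shaCardDvdPowAtTwoRT_onCut_of_selmerMinimalTwin'` — the same with U_T's trailing Kolyvagin-prime binders `(n) (d) hn hKoly hPn` kept (idle) before
  the cut, for uniformity with L_T;
* `natCard_primaryComponent_sha_two_dvd_pow_of_selmerMinimalTwin_onHabitat` — explicit binders, only Q2 `KolyvaginRelationAtTwo` as antecedent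
  (Q5R, the Q1-shape clause are idle and dropped).

Proof: (W1) gives `w(E) = 1`; PAIRCOUNT `#Ш(E/ℚ)[2^∞] ∣ 4^M₀`; SANDWICH′ `#Ш(E/K)[2^∞] ∣ 2·#Ш(E/ℚ)[2^∞]`; FIN `#Ш(E/K)[2^∞] = 4^t` (gk2-p5 g29
`exists_natCard_primaryComponent_sha_two_eq_pow_two_mul_onHabitat`) ⟹ `4^t ∣ 2·4^M₀` ⟹ `t ≤ M₀`.

References: [McCallumLMS1991] §5 Cor. 5.6; [Kramer1981] Thm. 1; [GrossLMS1991] Thm. 1.3, §5 Prop. 5.3; [Kolyvagin1990] Thm. A;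
[SilvermanAEC2009] Thm. X.4.14.
-/

set_option linter.dupNamespace false
set_option autoImplicit false

noncomputable section

namespace Summit.BirchSwinnertonDyer.BirchSwinnertonDyer.Theorems.GenusExact.RationalPairDescent

open scoped Classical
open WeierstrassCurve NumberField IsDedekindDomain Field
open Literature.NumberTheory.GaloisRepresentations Literature.NumberTheory.EllipticCurves
open Literature.NumberTheory
open Summit.BirchSwinnertonDyer.BirchSwinnertonDyer.Theses.GenusKolyvaginAtTwo
open Summit.BirchSwinnertonDyer.BirchSwinnertonDyer.Theorems.GenusExact.PlusDescent

/-- **U_T's conclusion on the cut R7-d, explicit binders, no sign hypothesis**: on U_T's frame (Q2 by name; habitat binders; `y_K = P(1)` of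
infinite order with `2^(M₀+1) ∤ y_K`), for every globally minimal elliptic `ℚ`-model `Wd ≅ E^(d_K)` with `#Sel₂(Wd) = 2` and `ord₂ c(Wd) ≤ 1`:
`#Ш(E/K)[2^∞] ∣ 2^(2M₀)`.  (W1) supplies `w(E) = 1`; then PAIRCOUNT, SANDWICH′ and FIN's `#Ш(E/K)[2^∞] = 4^t`.
[cite: McCallumLMS1991, §5 Cor. 5.6] [cite: Kramer1981, Thm. 1] [cite: GrossLMS1991, §5 Prop. 5.3] -/
theorem natCard_primaryComponent_sha_two_dvd_pow_of_selmerMinimalTwin_onHabitat (hQ2 : KolyvaginRelationAtTwo)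
    (hQ5R : EquivariantChebotarevAtTwoR)
    (hQ1 : ∀ (W : WeierstrassCurve ℚ) [W.IsElliptic], W.Δ < 0 → ∀ (c₀ : Field.absoluteGaloisGroup ℚ),
      IsComplexConjugation (Rat.castHom ℝ) c₀ → ∀ (M : ℕ), ∃ P : W.geomTorsion ((2 ^ M : ℕ) : ℤ), ∀ Q : W.geomTorsion ((2 ^ M : ℕ) : ℤ),
      ∃ a b : ℤ, Q = a • P + b • (c₀ • P))
    (W : WeierstrassCurve ℚ) [W.IsElliptic] [W.IsGloballyMinimal] [NeZero (W.conductorNorm ℤ)] (hcm : ¬ W.HasCM)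
    (hT : Odd W.tamagawaProduct) (v : HeightOneSpectrum (𝓞 ℚ)) (h2v : ((2 : ℕ) : 𝓞 ℚ) ∉ v.asIdeal)
    (hNv : ((W.conductorNorm ℤ : ℕ) : 𝓞 ℚ) ∈ v.asIdeal) (hmult : W.HasMultiplicativeReductionAt v) (hneg : W.Δ < 0)
    (K : Type) [Field K] [NumberField K] (hIQ : IsImaginaryQuadratic K) (hodd : Odd (NumberField.discr K))
    (h3 : NumberField.discr K ≠ -3) (hHe : SatisfiesHeegnerHypothesis (W.conductorNorm ℤ) K)
    (hsq1 : ¬ IsSquare ((NumberField.discr K : ℚ) * -|W.Δ|)) (hsq2 : ¬ IsSquare ((NumberField.discr K : ℚ) * (-(2 * |W.Δ|))))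
    (hρ : ∀ n : ℕ, 0 < n → W.HasSurjectiveModNGaloisRep ((2 : ℤ) ^ n))
    (Dt : ModularForms.ModularParametrizationData W (W.conductorNorm ℤ)) (β : ℤ) (ι : K →+* ℂ) (d₁ : KolyvaginHeegnerData Dt β ι 1)
    (hy : ¬ IsOfFinAddOrder d₁.derivedPoint) (M₀ : ℕ)
    (hdiv : ∃ Q : (W.baseChange (ringClassField K ι 1)).toAffine.Point, ((2 ^ M₀ : ℕ) : ℤ) • Q = d₁.derivedPoint)
    (hndiv : ¬ ∃ Q : (W.baseChange (ringClassField K ι 1)).toAffine.Point, ((2 ^ (M₀ + 1) : ℕ) : ℤ) • Q = d₁.derivedPoint)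
    (Wd : WeierstrassCurve ℚ) [Wd.IsElliptic] [Wd.IsGloballyMinimal]
    (hWd : ∃ C : VariableChange ℚ, C • W.quadraticTwist (NumberField.discr K : ℚ) = Wd)
    (hSel : Nat.card (Wd.selmerGroup 2) = 2) (hDEF : padicValNat 2 Wd.tamagawaProduct ≤ 1) :
    Nat.card (AddCommGroup.primaryComponent (W.baseChange K).sha 2) ∣ 2 ^ (2 * M₀) := by
  -- (W1): the 2-Selmer-minimal twin forces `w(E) = +1`
  have hw : W.rootNumber = 1 :=
    rootNumber_eq_one_of_natCard_selmerGroup_twin_eq_two_onHabitat hQ2 W hcm hT v h2v hNv hmult hneg K hIQ hodd h3 hHe hsq1 hsq2 hρ Dt β ι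
      d₁ hy M₀ hndiv Wd hWd hSel
  have hpair := stub_shaRatCardDvdOfMinimalTwin hQ2 hQ5R hQ1 W hcm hT v h2v hNv hmult hneg K hIQ hodd h3 hHe hsq1 hsq2 hρ Dt β ι d₁ hy
    M₀ hdiv hndiv hw Wd hWd hSel hDEF
  have hsand := stub_sandwichOfMinimalTwin hQ2 hQ5R hQ1 W hcm hT v h2v hNv hmult hneg K hIQ hodd h3 hHe hsq1 hsq2 hρ Dt β ι d₁ hy
    M₀ hdiv hndiv hw Wd hWd hSel hDEF
  -- `#X ∣ 2 · #Ш(E/ℚ)[2^∞] ∣ 2 · 4^M₀` and `#X = 4^t` ⟹ `t ≤ M₀`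
  have hX : Nat.card (AddCommGroup.primaryComponent (W.baseChange K).sha 2) ∣ 2 * 2 ^ (2 * M₀) :=
    hsand.trans (Nat.mul_dvd_mul_left 2 hpair)
  obtain ⟨t, ht⟩ := exists_natCard_primaryComponent_sha_two_eq_pow_two_mul_onHabitat hQ2 W hcm hT v h2v hNv hmult hneg K hIQ hodd h3 hHe
    hsq1 hsq2 hρ Dt β ι d₁ M₀ hndiv
  rw [ht] at hX ⊢
  rw [show 2 * 2 ^ (2 * M₀) = 2 ^ (2 * M₀ + 1) by ring] at hX
  have htM : 2 * t ≤ 2 * M₀ + 1 := (Nat.pow_dvd_pow_iff_le_right (by norm_num)).mp hX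
  exact Nat.pow_dvd_pow 2 (by omega)

/-- **U_T ON THE CUT R7-d, NO SIGN BINDER — the restatement text**: U_T's rev-37 binders VERBATIM through `hndiv`, then «a globally minimal elliptic
`ℚ`-model `Wd` of `E^(d_K)` with `#Sel₂(Wd) = 2` and `ord₂ c(Wd) ≤ 1`», then U_T's conclusion `#Ш(E/K)[2^∞] ∣ 2^(2M₀)`.  = LEAD's proposed U_T′
(`RESTATEMENT-UT-cut-g19.md` §2) with the binder `W.rootNumber = 1 →` deleted ((W1) supplies it).  If the pen files U_T′ in this shape, its
closer is `exact shaCardDvdPowAtTwoRT_onCut_of_selmerMinimalTwin`.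
[cite: McCallumLMS1991, §5 Cor. 5.6] [cite: Kramer1981, Thm. 1] [cite: GrossLMS1991, §5 Prop. 5.3] -/
theorem shaCardDvdPowAtTwoRT_onCut_of_selmerMinimalTwin :
    KolyvaginRelationAtTwo → EquivariantChebotarevAtTwoR → (∀ (W : WeierstrassCurve ℚ) [W.IsElliptic], W.Δ < 0 → ∀ (c₀ : Field.absoluteGaloisGroup ℚ), Literature.NumberTheory.GaloisRepresentations.IsComplexConjugation (Rat.castHom ℝ) c₀ → ∀ (M : ℕ), ∃ P : W.geomTorsion ((2 ^ M : ℕ) : ℤ), ∀ Q : W.geomTorsion ((2 ^ M : ℕ) : ℤ), ∃ a b : ℤ, Q = a • P + b • (c₀ • P)) → ∀ (W : WeierstrassCurve ℚ) [W.IsElliptic] [W.IsGloballyMinimal] [NeZero (W.conductorNorm ℤ)], ¬ W.HasCM → Odd W.tamagawaProduct → ∀ (v : IsDedekindDomain.HeightOneSpectrum (NumberField.RingOfIntegers ℚ)), ((2 : ℕ) : NumberField.RingOfIntegers ℚ) ∉ v.asIdeal → ((W.conductorNorm ℤ : ℕ) : NumberField.RingOfIntegers ℚ) ∈ v.asIdeal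 → W.HasMultiplicativeReductionAt v → W.Δ < 0 → ∀ (K : Type) [Field K] [NumberField K], Literature.NumberTheory.EllipticCurves.IsImaginaryQuadratic K → Odd (NumberField.discr K) → NumberField.discr K ≠ -3 → Literature.NumberTheory.EllipticCurves.SatisfiesHeegnerHypothesis (W.conductorNorm ℤ) K → ¬ IsSquare ((NumberField.discr K : ℚ) * -|W.Δ|) → ¬ IsSquare ((NumberField.discr K : ℚ) * (-(2 * |W.Δ|))) → (∀ n : ℕ, 0 < n → W.HasSurjectiveModNGaloisRep ((2 : ℤ) ^ n)) → ∀ (Dt : Literature.NumberTheory.EllipticCurves.ModularForms.ModularParametrizationData W (W.conductorNorm ℤ)) (β : ℤ) (ι : K →+* ℂ) (d₁ : Literature.NumberTheory.EllipticCurves.KolyvaginHeegnerData Dt β ι 1), ¬ IsOfFinAddOrder d₁.derivedPoint → ∀ (M₀ : ℕ), (∃ Q : (W.baseChange (Literature.NumberTheory.EllipticCurves.ringClassField K ι 1)).toAffine.Point, ((2 ^ M₀ : ℕ) : ℤ) • Q = d₁.derivedPoint) → (¬ ∃ Q : (W.baseChange (Literature.NumberTheory.EllipticCurves.ringClassField K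 ι 1)).toAffine.Point, ((2 ^ (M₀ + 1) : ℕ) : ℤ) • Q = d₁.derivedPoint) →
      ∀ (Wd : WeierstrassCurve ℚ) [Wd.IsElliptic] [Wd.IsGloballyMinimal],
        (∃ C : WeierstrassCurve.VariableChange ℚ, C • W.quadraticTwist (NumberField.discr K : ℚ) = Wd) →
        Nat.card (Wd.selmerGroup 2) = 2 → padicValNat 2 Wd.tamagawaProduct ≤ 1 →
        Nat.card (AddCommGroup.primaryComponent (W.baseChange K).sha 2) ∣ 2 ^ (2 * M₀) := by
  intro hQ2 hQ5R hQ1 W _ _ _ hcm hT v h2v hNv hmult hneg K _ _ hIQ hodd h3 hHe hsq1 hsq2 hρ Dt β ι d₁ hy M₀ hdiv hndiv Wd _ _ hWd hSel hDEF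
  exact natCard_primaryComponent_sha_two_dvd_pow_of_selmerMinimalTwin_onHabitat hQ2 hQ5R hQ1 W hcm hT v h2v hNv hmult hneg K hIQ hodd h3
    hHe hsq1 hsq2 hρ Dt β ι d₁ hy M₀ hdiv hndiv Wd hWd hSel hDEF

/-- **U_T ON THE CUT R7-d, NO SIGN BINDER, with U_T's trailing Kolyvagin-prime binders kept (idle)** — the shape uniform with L_T: U_T's rev-37
statement VERBATIM with the three cut binders inserted just before the conclusion.  If the pen files U_T′ in this shape, its closer is
`exact shaCardDvdPowAtTwoRT_onCut_of_selmerMinimalTwin'`.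
[cite: McCallumLMS1991, §5 Cor. 5.6] [cite: Kramer1981, Thm. 1] [cite: GrossLMS1991, §5 Prop. 5.3] -/
theorem shaCardDvdPowAtTwoRT_onCut_of_selmerMinimalTwin' :
    KolyvaginRelationAtTwo → EquivariantChebotarevAtTwoR → (∀ (W : WeierstrassCurve ℚ) [W.IsElliptic], W.Δ < 0 → ∀ (c₀ : Field.absoluteGaloisGroup ℚ), Literature.NumberTheory.GaloisRepresentations.IsComplexConjugation (Rat.castHom ℝ) c₀ → ∀ (M : ℕ), ∃ P : W.geomTorsion ((2 ^ M : ℕ) : ℤ), ∀ Q : W.geomTorsion ((2 ^ M : ℕ) : ℤ), ∃ a b : ℤ, Q = a • P + b • (c₀ • P)) → ∀ (W : WeierstrassCurve ℚ) [W.IsElliptic] [W.IsGloballyMinimal] [NeZero (W.conductorNorm ℤ)], ¬ W.HasCM → Odd W.tamagawaProduct → ∀ (v : IsDedekindDomain.HeightOneSpectrum (NumberField.RingOfIntegers ℚ)), ((2 : ℕ) : NumberField.RingOfIntegers ℚ) ∉ v.asIdeal → ((W.conductorNorm ℤ : ℕ) : NumberField.RingOfIntegers ℚ) ∈ v.asIdeal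 → W.HasMultiplicativeReductionAt v → W.Δ < 0 → ∀ (K : Type) [Field K] [NumberField K], Literature.NumberTheory.EllipticCurves.IsImaginaryQuadratic K → Odd (NumberField.discr K) → NumberField.discr K ≠ -3 → Literature.NumberTheory.EllipticCurves.SatisfiesHeegnerHypothesis (W.conductorNorm ℤ) K → ¬ IsSquare ((NumberField.discr K : ℚ) * -|W.Δ|) → ¬ IsSquare ((NumberField.discr K : ℚ) * (-(2 * |W.Δ|))) → (∀ n : ℕ, 0 < n → W.HasSurjectiveModNGaloisRep ((2 : ℤ) ^ n)) → ∀ (Dt : Literature.NumberTheory.EllipticCurves.ModularForms.ModularParametrizationData W (W.conductorNorm ℤ)) (β : ℤ) (ι : K →+* ℂ) (d₁ : Literature.NumberTheory.EllipticCurves.KolyvaginHeegnerData Dt β ι 1), ¬ IsOfFinAddOrder d₁.derivedPoint → ∀ (M₀ : ℕ), (∃ Q : (W.baseChange (Literature.NumberTheory.EllipticCurves.ringClassField K ι 1)).toAffine.Point, ((2 ^ M₀ : ℕ) : ℤ) • Q = d₁.derivedPoint) → (¬ ∃ Q : (W.baseChange (Literature.NumberTheory.EllipticCurves.ringClassField K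 ι 1)).toAffine.Point, ((2 ^ (M₀ + 1) : ℕ) : ℤ) • Q = d₁.derivedPoint) → ∀ (n : ℕ) (d : Literature.NumberTheory.EllipticCurves.KolyvaginHeegnerData Dt β ι n), Squarefree n → (∀ ℓ ∈ n.primeFactors, Literature.NumberTheory.EllipticCurves.Zhang2014.IsKolyvaginPrime (W.conductorNorm ℤ) W K 2 ℓ ∧ 2 ≤ Literature.NumberTheory.EllipticCurves.Zhang2014.kolyvaginIndex W 2 ℓ ∧ Literature.NumberTheory.EllipticCurves.FrobEqFrobInfty W K 2 ℓ) → (¬ ∃ Q : (W.baseChange (Literature.NumberTheory.EllipticCurves.ringClassField K ι n)).toAffine.Point, (2 : ℤ) • Q = d.derivedPoint) →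
      ∀ (Wd : WeierstrassCurve ℚ) [Wd.IsElliptic] [Wd.IsGloballyMinimal],
        (∃ C : WeierstrassCurve.VariableChange ℚ, C • W.quadraticTwist (NumberField.discr K : ℚ) = Wd) →
        Nat.card (Wd.selmerGroup 2) = 2 → padicValNat 2 Wd.tamagawaProduct ≤ 1 →
        Nat.card (AddCommGroup.primaryComponent (W.baseChange K).sha 2) ∣ 2 ^ (2 * M₀) := by
  intro hQ2 hQ5R hQ1 W _ _ _ hcm hT v h2v hNv hmult hneg K _ _ hIQ hodd h3 hHe hsq1 hsq2 hρ Dt β ι d₁ hy M₀ hdiv hndiv _n _d _ _ _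
    Wd _ _ hWd hSel hDEF
  exact natCard_primaryComponent_sha_two_dvd_pow_of_selmerMinimalTwin_onHabitat hQ2 hQ5R hQ1 W hcm hT v h2v hNv hmult hneg K hIQ hodd h3
    hHe hsq1 hsq2 hρ Dt β ι d₁ hy M₀ hdiv hndiv Wd hWd hSel hDEF

end Summit.BirchSwinnertonDyer.BirchSwinnertonDyer.Theorems.GenusExact.RationalPairDescent

end
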